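import Summits.ResolutionOfSingularities.ResolutionOfSingularities.Theorems.WeightedInvariantContactCylinderGlobalMoveRegular
import Summits.ResolutionOfSingularities.ResolutionOfSingularities.Theorems.WeightedInvariantIotaUpperSemicontinuousAffine
import Summits.ResolutionOfSingularities.ResolutionOfSingularities.Theorems.WeightedInvariantIotaOrderUpperSemicontinuous
import Summits.ResolutionOfSingularities.ResolutionOfSingularities.Theorems.IndSmoothValuativeSmoothingSmoothBlowupChart
import Summits.ResolutionOfSingularities.ResolutionOfSingularities.Theorems.WeightedInvariantOrderNonIncreasePartial
import Mathlib.RingTheory.RingHom.FinitePresentation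
import Mathlib.Topology.Constructible
import HarnessLib

/-!
# THE GLOBAL CYLINDER MOVE: the three Chevalley inputs on `Spec B` — finite presentation, the exceptional locus lies over the
# centre, and the super-level sets of the order of the transform are closed / the no-drop locus is constructible
# ((D2-W) for res-type-047's HCURVE step; door `HypersurfaceCentreConstruction`, stmt-ResolutionOfSingularities-19897, regime P3a)

Topic: `Summits/ResolutionOfSingularities/ResolutionOfSingularities/Theorems`. Helper for the door item
`HypersurfaceCentreConstruction` (stmt-ResolutionOfSingularities-19897, route `WeightedInvariant`), line `local-engine` of
res-L1-w43-plan-1 (L W4.3).  No new objects.  res-type-047's Chevalley lemma `TieFinite.finite_image_comap_of_isConstructible`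
(p536684) consumes, for `φ = algebraMap A_h B` (`B = extReesAlgebra (weightedMonomialIdeal (U/1) W)` the global move):
(F) `φ.FinitePresentation`; (WP) every point of the constructible set lies over `V(P)`; (W) the set is constructible.  This file
supplies the `B`-side facts in ring-level letters (`PrimeSpectrum B`, `Localization.AtPrime`):
* `finitePresentation_algebraMap_extReesAlgebra_weightedMonomialIdeal` — (F) over a Noetherian base;
* `algebraMap_mem_of_tInv_mem` / `span_range_le_comap_of_tInv_mem` — (WP): a prime `𝔫 ∋ t⁻¹` of `B` contracts to a prime
  containing the centre `(U)` (`uᵢ = (uᵢ t^{wᵢ}) · (t⁻¹)^{wᵢ}`, res-type-098's `algebraMap_eq_tInv_pow_mul_rT`);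
* `isClosed_setOf_le_iotaOrd_atPrime` — for ANY regular algebra `B` of finite type over a perfect field and `G ∈ B`, `α`:
  `{𝔫 ∈ Spec B | α ≤ ord_{B_𝔫}(G/1)}` is closed (regular + perfect ⇒ smooth, `ValuativeSmoothing.smooth_of_isRegularRing_of_perfectField`;
  then the affine (c8) bridge `isClosed_setOf_le_iota_atPrime` with `iotaOrd_upperSemicontinuous`); membership form
  `isClosed_setOf_algebraMap_mem_maximalIdeal_pow`;
* `isOpen_setOf_not_mem`, `isConstructible_of_isClosed` / `_of_isOpen` (Noetherian spectra), and the no-drop locus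
  `isConstructible_noDropLocus`: `{𝔫 | t ∈ 𝔫, X ∉ 𝔫, G/1 ∈ 𝔪_𝔫ⁿ}` is constructible;
* the door packaging `globalMove_chevalleyInputs`: over the basic open of `exists_basicOpen_isRegularRing_globalMove` (p537945) and every
  shrink `h h'`, (F) and (W) hold for the global cylinder move.

[OURS · L1 W4.3 · (o28)/(D2)]  Replaces the role of NO printed item; NOT a statement of the manuscript
[claim: Hironaka2017, status: under-review]. AI work, weaker than expert review.  Pure commutative algebra; no named facts.

## References

* A. Grothendieck, EGA IV₁ 1.8.4 (Chevalley's constructibility theorem) — Mathlib `PrimeSpectrum.isConstructible_comap_image`.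
* H. Matsumura, *Commutative Ring Theory*, §30 Remark 2 (regular over a perfect field ⇒ smooth). [Matsumura1987]
* res-type-047 2026-08-27T14:16:31Z / 14:37:57Z (HCURVE inputs by name; OURS, AI planning).
-/

noncomputable section

open IsLocalRing Literature.AlgebraicGeometry.Resolution LaurentPolynomial Topology
open Summit.ResolutionOfSingularities.ResolutionOfSingularities.Cruxes.HypersurfaceCentreConstruction.LocalEngine

set_option linter.dupNamespace false -- mandated namespace of this single-conjunct summit

namespace Summit.ResolutionOfSingularities.ResolutionOfSingularities.Theorems

namespace ContactCylinder

/-! ## (F) finite presentation of the global move -/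

/-- **(F)** Over a Noetherian base the global move `B = extReesAlgebra (weightedMonomialIdeal U W)` is of finite presentation:
`(algebraMap A B).FinitePresentation` (finite type, p537945, + Noetherian base). [folklore] -/
theorem finitePresentation_algebraMap_extReesAlgebra_weightedMonomialIdeal {A : Type} [CommRing A] [IsNoetherianRing A] {m : ℕ}
    (U : Fin m → A) (W : Fin m → ℕ) :
    (algebraMap A (extReesAlgebra (weightedMonomialIdeal U W))).FinitePresentation := by
  haveI := finiteType_extReesAlgebra_weightedMonomialIdeal U W
  haveI : Algebra.FinitePresentation A (extReesAlgebra (weightedMonomialIdeal U W)) :=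
    (Algebra.FinitePresentation.of_finiteType).mp inferInstance
  exact RingHom.finitePresentation_algebraMap.mpr inferInstance

/-! ## (WP) the exceptional locus `V(t⁻¹)` lies over the centre `V(U)` -/

/-- **A prime `𝔫 ∋ t⁻¹` of the global move contains every member `uᵢ` of the centre with positive weight**:
`uᵢ = (uᵢ t^{wᵢ}) · (t⁻¹)^{wᵢ}`. [cite: Wlodarczyk2022, Lemma 2.3.8] -/
theorem algebraMap_mem_of_tInv_mem {A : Type} [CommRing A] {m : ℕ} (U : Fin m → A) (W : Fin m → ℕ)
    (𝔫 : Ideal (extReesAlgebra (weightedMonomialIdeal U W))) (ht : extReesAlgebra.tInv (weightedMonomialIdeal U W) ∈ 𝔫)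
    {i : Fin m} (hW : 0 < W i) :
    algebraMap A (extReesAlgebra (weightedMonomialIdeal U W)) (U i) ∈ 𝔫 := by
  rw [OrderNonIncreasePartial.algebraMap_eq_tInv_pow_mul_rT U W hW (mem_weightedMonomialIdeal_self U W i)]
  exact Ideal.mul_mem_right _ _ (Ideal.pow_mem_of_mem 𝔫 ht _ hW)

/-- Hence `(U) ≤ 𝔫 ∩ A` for every prime (indeed every ideal) `𝔫 ∋ t⁻¹` of the global move of a centre with positive weights — the
points of the exceptional divisor lie over `V(U)`. [cite: Wlodarczyk2022, Lemma 2.3.8] -/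
theorem span_range_le_comap_of_tInv_mem {A : Type} [CommRing A] {m : ℕ} (U : Fin m → A) (W : Fin m → ℕ) (hW : ∀ i, 0 < W i)
    (𝔫 : Ideal (extReesAlgebra (weightedMonomialIdeal U W))) (ht : extReesAlgebra.tInv (weightedMonomialIdeal U W) ∈ 𝔫) :
    Ideal.span (Set.range U) ≤ 𝔫.comap (algebraMap A (extReesAlgebra (weightedMonomialIdeal U W))) := by
  refine Ideal.span_le.mpr ?_
  rintro _ ⟨i, rfl⟩
  exact Ideal.mem_comap.mpr (algebraMap_mem_of_tInv_mem U W 𝔫 ht (hW i))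

/-- The same for any ideal `P ≤ (U)` of the base (e.g. the curve's prime `P = (x', g')` itself): `P ≤ 𝔫 ∩ A`. [folklore] -/
theorem le_comap_of_tInv_mem {A : Type} [CommRing A] {m : ℕ} (U : Fin m → A) (W : Fin m → ℕ) (hW : ∀ i, 0 < W i)
    {P : Ideal A} (hP : P ≤ Ideal.span (Set.range U))
    (𝔫 : Ideal (extReesAlgebra (weightedMonomialIdeal U W))) (ht : extReesAlgebra.tInv (weightedMonomialIdeal U W) ∈ 𝔫) :
    P ≤ 𝔫.comap (algebraMap A (extReesAlgebra (weightedMonomialIdeal U W))) :=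
  hP.trans (span_range_le_comap_of_tInv_mem U W hW 𝔫 ht)

/-! ## (W) super-level sets of the order are closed on the spectrum of a regular algebra of finite type over a perfect field -/

/-- **Ring-level upper semicontinuity of the order on a regular affine scheme over a perfect field.**  `B` a regular ring of finite type
over a perfect field `k`, `G ∈ B`, `α` an ordinal: `{𝔫 ∈ Spec B | α ≤ iotaOrd (B_𝔫) (G/1)}` is closed in `PrimeSpectrum B` (regular of
finite type over a perfect field ⇒ smooth; (c8) for `iotaOrd` read on `Spec B` through the affine bridge).
[cite: Matsumura1987, §30 Remark 2; CossartPiltant2008, Prop. 4.2 (proof)] -/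
theorem isClosed_setOf_le_iotaOrd_atPrime (k B : Type) [Field k] [PerfectField k] [CommRing B] [Algebra k B] [Algebra.FiniteType k B]
    [IsRegularRing B] (G : B) (α : Ordinal.{0}) :
    IsClosed {𝔫 : PrimeSpectrum B | α ≤ iotaOrd (Localization.AtPrime 𝔫.asIdeal) (algebraMap B _ G)} := by
  haveI : Algebra.Smooth k B := ValuativeSmoothing.smooth_of_isRegularRing_of_perfectField k B
  exact isClosed_setOf_le_iota_atPrime iotaOrd_isoInvariant iotaOrd_upperSemicontinuous k B G α

/-- Membership form: `{𝔫 ∈ Spec B | G/1 ∈ 𝔪_{B_𝔫}ⁿ}` is closed (`natCast_le_iotaOrd_iff`). [cite: CossartPiltant2008, Prop. 4.2 (proof)] -/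
theorem isClosed_setOf_algebraMap_mem_maximalIdeal_pow (k B : Type) [Field k] [PerfectField k] [CommRing B] [Algebra k B]
    [Algebra.FiniteType k B] [IsRegularRing B] (G : B) (n : ℕ) :
    IsClosed {𝔫 : PrimeSpectrum B | algebraMap B (Localization.AtPrime 𝔫.asIdeal) G ∈ maximalIdeal (Localization.AtPrime 𝔫.asIdeal) ^ n} := by
  have hset : {𝔫 : PrimeSpectrum B | algebraMap B (Localization.AtPrime 𝔫.asIdeal) G ∈ maximalIdeal (Localization.AtPrime 𝔫.asIdeal) ^ n} =
      {𝔫 : PrimeSpectrum B | (n : Ordinal.{0}) ≤ iotaOrd (Localization.AtPrime 𝔫.asIdeal) (algebraMap B _ G)} := by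
    ext 𝔫
    rw [Set.mem_setOf_eq, Set.mem_setOf_eq, natCast_le_iotaOrd_iff]
  rw [hset]
  exact isClosed_setOf_le_iotaOrd_atPrime k B G n

/-! ## Constructibility on Noetherian spectra and the no-drop locus -/

/-- `{𝔫 | X ∉ 𝔫}` is the basic open set `D(X)`. [folklore] -/
theorem isOpen_setOf_not_mem {B : Type} [CommRing B] (X : B) : IsOpen {𝔫 : PrimeSpectrum B | X ∉ 𝔫.asIdeal} :=
  (PrimeSpectrum.basicOpen X).isOpen

/-- `{𝔫 | t ∈ 𝔫}` is the closed set `V(t)`. [folklore] -/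
theorem isClosed_setOf_mem {B : Type} [CommRing B] (t : B) : IsClosed {𝔫 : PrimeSpectrum B | t ∈ 𝔫.asIdeal} := by
  have : {𝔫 : PrimeSpectrum B | t ∈ 𝔫.asIdeal} = PrimeSpectrum.zeroLocus {t} := by
    ext 𝔫; simp [PrimeSpectrum.mem_zeroLocus]
  rw [this]
  exact PrimeSpectrum.isClosed_zeroLocus _

/-- On the spectrum of a Noetherian ring every open set is constructible (it is compact). [folklore] -/
theorem isConstructible_of_isOpen {B : Type} [CommRing B] [IsNoetherianRing B] {s : Set (PrimeSpectrum B)} (hs : IsOpen s) :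
    IsConstructible s :=
  (TopologicalSpace.NoetherianSpace.isCompact s).isConstructible hs

/-- On the spectrum of a Noetherian ring every closed set is constructible. [folklore] -/
theorem isConstructible_of_isClosed {B : Type} [CommRing B] [IsNoetherianRing B] {s : Set (PrimeSpectrum B)} (hs : IsClosed s) :
    IsConstructible s := by
  rw [← compl_compl s]
  exact (isConstructible_of_isOpen hs.isOpen_compl).compl

/-- **(W) THE NO-DROP LOCUS IS CONSTRUCTIBLE.**  `B` regular of finite type over a perfect field, `t, X, G ∈ B`, `n`:
`{𝔫 ∈ Spec B | t ∈ 𝔫, X ∉ 𝔫, G/1 ∈ 𝔪_{B_𝔫}ⁿ}` (exceptional divisor ∩ the `X`-chart ∩ «order of the transform at least `n`») is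
constructible in `PrimeSpectrum B` — the input `hW` of `TieFinite.finite_image_comap_of_isConstructible`. [folklore] -/
theorem isConstructible_noDropLocus (k B : Type) [Field k] [PerfectField k] [CommRing B] [Algebra k B] [Algebra.FiniteType k B]
    [IsRegularRing B] (t X G : B) (n : ℕ) :
    IsConstructible {𝔫 : PrimeSpectrum B | t ∈ 𝔫.asIdeal ∧ X ∉ 𝔫.asIdeal ∧
      algebraMap B (Localization.AtPrime 𝔫.asIdeal) G ∈ maximalIdeal (Localization.AtPrime 𝔫.asIdeal) ^ n} := by
  have hset : {𝔫 : PrimeSpectrum B | t ∈ 𝔫.asIdeal ∧ X ∉ 𝔫.asIdeal ∧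
      algebraMap B (Localization.AtPrime 𝔫.asIdeal) G ∈ maximalIdeal (Localization.AtPrime 𝔫.asIdeal) ^ n} =
      {𝔫 : PrimeSpectrum B | t ∈ 𝔫.asIdeal} ∩ ({𝔫 : PrimeSpectrum B | X ∉ 𝔫.asIdeal} ∩
        {𝔫 : PrimeSpectrum B | algebraMap B (Localization.AtPrime 𝔫.asIdeal) G ∈
          maximalIdeal (Localization.AtPrime 𝔫.asIdeal) ^ n}) := by
    ext 𝔫; simp only [Set.mem_setOf_eq, Set.mem_inter_iff]
  rw [hset]
  exact (isConstructible_of_isClosed (isClosed_setOf_mem t)).inter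
    ((isConstructible_of_isOpen (isOpen_setOf_not_mem X)).inter
      (isConstructible_of_isClosed (isClosed_setOf_algebraMap_mem_maximalIdeal_pow k B G n)))

/-! ## The door packaging: (F), (WP), (W) for the global cylinder move over the basic open of p537945, every shrink free -/

/-- **(D2-W) CHEVALLEY INPUTS FOR THE GLOBAL CYLINDER MOVE.**  `A` of finite type over a perfect field `k`, `𝔭` a prime with `A_𝔭`
regular of dimension `2`, `(x, g) A_𝔭 = 𝔭 A_𝔭`, `b ≥ 1`.  There is `h ∉ 𝔭` such that for EVERY `h' ∈ A`, with
`B := extReesAlgebra (weightedMonomialIdeal (x/1, g/1) (1, b))` over `A_{h h'}`: (F) `algebraMap A_{h h'} B` is of finite presentation;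
(WP) every prime `𝔫 ∋ t⁻¹` of `B` contracts to a prime containing `x/1, g/1`; (W) for all `t, X, G ∈ B` and `n`, the locus
`{𝔫 | t ∈ 𝔫, X ∉ 𝔫, G/1 ∈ 𝔪_𝔫ⁿ}` is constructible — together with the regularity/uniform-pair clauses of
`exists_basicOpen_isRegularRing_globalMove`. [cite: Wlodarczyk2022, §2.3.9; Matsumura1987, §30] -/
theorem globalMove_chevalleyInputs (k : Type) [Field k] [PerfectField k] (A : Type) [CommRing A] [Algebra k A]
    [Algebra.FiniteType k A] (𝔭 : Ideal A) [𝔭.IsPrime] [IsRegularLocalRing (Localization.AtPrime 𝔭)]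
    (hdim : ringKrullDim (Localization.AtPrime 𝔭) = 2) (x g : A)
    (hxg : (Ideal.span {x, g}).map (algebraMap A (Localization.AtPrime 𝔭)) = maximalIdeal (Localization.AtPrime 𝔭))
    (b : ℕ) (hb : 1 ≤ b) :
    ∃ h ∉ 𝔭,
      (∀ (𝔮 : Ideal A) [𝔮.IsPrime], h ∉ 𝔮 → IsRegularLocalRing (Localization.AtPrime 𝔮)) ∧
      (∀ (𝔮 : Ideal A) [𝔮.IsPrime], h ∉ 𝔮 → x ∈ 𝔮 → g ∈ 𝔮 →
        𝔭 ≤ 𝔮 ∧ IsRegularLocalRing (Localization.AtPrime 𝔮) ∧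
        (Ideal.span {x, g}).map (algebraMap A (Localization.AtPrime 𝔮)) = 𝔭.map (algebraMap A (Localization.AtPrime 𝔮)) ∧
        ∃ h𝔮 : ∀ i, algebraMap A (Localization.AtPrime 𝔮) ((![x, g] : Fin 2 → A) i) ∈ maximalIdeal (Localization.AtPrime 𝔮),
          LinearIndependent (ResidueField (Localization.AtPrime 𝔮)) fun i =>
            (maximalIdeal (Localization.AtPrime 𝔮)).toCotangent ⟨algebraMap A _ ((![x, g] : Fin 2 → A) i), h𝔮 i⟩) ∧
      ∀ h' : A,
        IsRegularRing (Localization.Away (h * h')) ∧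
        IsRegularRing (extReesAlgebra (weightedMonomialIdeal
          (fun i => algebraMap A (Localization.Away (h * h')) ((![x, g] : Fin 2 → A) i)) ![1, b])) ∧
        (algebraMap (Localization.Away (h * h')) (extReesAlgebra (weightedMonomialIdeal
          (fun i => algebraMap A (Localization.Away (h * h')) ((![x, g] : Fin 2 → A) i)) ![1, b]))).FinitePresentation ∧
        (∀ (𝔫 : Ideal (extReesAlgebra (weightedMonomialIdeal
            (fun i => algebraMap A (Localization.Away (h * h')) ((![x, g] : Fin 2 → A) i)) ![1, b]))),
          extReesAlgebra.tInv _ ∈ 𝔫 →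
            Ideal.span (Set.range fun i => algebraMap A (Localization.Away (h * h')) ((![x, g] : Fin 2 → A) i)) ≤
              𝔫.comap (algebraMap _ _)) ∧
        ∀ (t X G : extReesAlgebra (weightedMonomialIdeal
            (fun i => algebraMap A (Localization.Away (h * h')) ((![x, g] : Fin 2 → A) i)) ![1, b])) (n : ℕ),
          IsConstructible {𝔫 : PrimeSpectrum (extReesAlgebra (weightedMonomialIdeal
              (fun i => algebraMap A (Localization.Away (h * h')) ((![x, g] : Fin 2 → A) i)) ![1, b])) |
            t ∈ 𝔫.asIdeal ∧ X ∉ 𝔫.asIdeal ∧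
              algebraMap _ (Localization.AtPrime 𝔫.asIdeal) G ∈ maximalIdeal (Localization.AtPrime 𝔫.asIdeal) ^ n} := by
  haveI : IsNoetherianRing A := Algebra.FiniteType.isNoetherianRing k A
  obtain ⟨h, hh𝔭, Hreg, Hpair, H⟩ := exists_basicOpen_isRegularRing_globalMove k A 𝔭 hdim x g hxg b hb
  refine ⟨h, hh𝔭, Hreg, Hpair, fun h' => ?_⟩
  obtain ⟨hAreg, hFT, hBreg, -⟩ := H h'
  have hW : ∀ i, 0 < (![1, b] : Fin 2 → ℕ) i := by
    intro i; fin_cases i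
    · exact Nat.one_pos
    · exact hb
  haveI : IsNoetherianRing (Localization.Away (h * h')) :=
    IsLocalization.isNoetherianRing (Submonoid.powers (h * h')) (Localization.Away (h * h')) inferInstance
  haveI := hBreg
  -- `B` is of finite type over the perfect field `k` (through `A → A_{h h'} → B`)
  haveI : Algebra.FiniteType k (Localization.Away (h * h')) :=
    Algebra.FiniteType.trans (S := A) inferInstance (IsLocalization.finiteType_of_monoid_fg (Submonoid.powers (h * h')) _)
  haveI := hFT
  haveI : Algebra.FiniteType k (extReesAlgebra (weightedMonomialIdeal
      (fun i => algebraMap A (Localization.Away (h * h')) ((![x, g] : Fin 2 → A) i)) ![1, b])) :=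
    Algebra.FiniteType.trans (S := Localization.Away (h * h')) inferInstance inferInstance
  exact ⟨hAreg, hBreg, finitePresentation_algebraMap_extReesAlgebra_weightedMonomialIdeal _ _,
    fun 𝔫 ht => span_range_le_comap_of_tInv_mem _ _ hW 𝔫 ht, fun t X G n => isConstructible_noDropLocus k _ t X G n⟩

/-! ## rev 2: the no-drop locus in VERTEX form (res-type-047 SPEC v2: `W` on the whole regular `B`, no chart) -/

/-- `{𝔫 | ¬ J ≤ 𝔫}` is open: the complement of `V(J)`. [folklore] -/
theorem isOpen_setOf_not_le {B : Type} [CommRing B] (J : Ideal B) : IsOpen {𝔫 : PrimeSpectrum B | ¬ J ≤ 𝔫.asIdeal} := by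
  have : {𝔫 : PrimeSpectrum B | ¬ J ≤ 𝔫.asIdeal} = (PrimeSpectrum.zeroLocus (J : Set B))ᶜ := by
    ext 𝔫
    simp only [Set.mem_setOf_eq, Set.mem_compl_iff, PrimeSpectrum.mem_zeroLocus, SetLike.coe_subset_coe]
  rw [this]
  exact (PrimeSpectrum.isClosed_zeroLocus _).isOpen_compl

/-- **(W), VERTEX FORM: `{𝔫 ∈ Spec B | t ∈ 𝔫, V ⊄ 𝔫, G/1 ∈ 𝔪_{B_𝔫}ⁿ}` is constructible** (`B` regular of finite type over a perfect field;
`V` any ideal — the vertex ideal of the move; res-type-047's SPEC v2 reads the no-drop locus on the whole regular `B`, off the vertex,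
without choosing a chart). [folklore] -/
theorem isConstructible_noDropLocus_vertex (k B : Type) [Field k] [PerfectField k] [CommRing B] [Algebra k B] [Algebra.FiniteType k B]
    [IsRegularRing B] (t G : B) (V : Ideal B) (n : ℕ) :
    IsConstructible {𝔫 : PrimeSpectrum B | t ∈ 𝔫.asIdeal ∧ ¬ V ≤ 𝔫.asIdeal ∧
      algebraMap B (Localization.AtPrime 𝔫.asIdeal) G ∈ maximalIdeal (Localization.AtPrime 𝔫.asIdeal) ^ n} := by
  have hset : {𝔫 : PrimeSpectrum B | t ∈ 𝔫.asIdeal ∧ ¬ V ≤ 𝔫.asIdeal ∧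
      algebraMap B (Localization.AtPrime 𝔫.asIdeal) G ∈ maximalIdeal (Localization.AtPrime 𝔫.asIdeal) ^ n} =
      {𝔫 : PrimeSpectrum B | t ∈ 𝔫.asIdeal} ∩ ({𝔫 : PrimeSpectrum B | ¬ V ≤ 𝔫.asIdeal} ∩
        {𝔫 : PrimeSpectrum B | algebraMap B (Localization.AtPrime 𝔫.asIdeal) G ∈
          maximalIdeal (Localization.AtPrime 𝔫.asIdeal) ^ n}) := by
    ext 𝔫; simp only [Set.mem_setOf_eq, Set.mem_inter_iff]
  rw [hset]
  exact (isConstructible_of_isClosed (isClosed_setOf_mem t)).inter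
    ((isConstructible_of_isOpen (isOpen_setOf_not_le V)).inter
      (isConstructible_of_isClosed (isClosed_setOf_algebraMap_mem_maximalIdeal_pow k B G n)))

/-! ## rev 3 (res-type-047 ask (a), RULING #10 (V-AQS)): the door packaging with ARBITRARY positive weights `W : Fin 2 → ℕ` -/

/-- **(D2-W) CHEVALLEY INPUTS FOR THE GLOBAL MOVE ON A PAIR WITH ARBITRARY POSITIVE WEIGHTS** (`W = (r, q)` for the lex-max datum of
the (V-AQS) route): as `globalMove_chevalleyInputs`, for `B := extReesAlgebra (weightedMonomialIdeal (x/1, g/1) W)` over `A_{h h'}`.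
[cite: Wlodarczyk2022, §2.3.9; Matsumura1987, §30] -/
theorem globalMove_chevalleyInputs' (k : Type) [Field k] [PerfectField k] (A : Type) [CommRing A] [Algebra k A]
    [Algebra.FiniteType k A] (𝔭 : Ideal A) [𝔭.IsPrime] [IsRegularLocalRing (Localization.AtPrime 𝔭)]
    (hdim : ringKrullDim (Localization.AtPrime 𝔭) = 2) (x g : A)
    (hxg : (Ideal.span {x, g}).map (algebraMap A (Localization.AtPrime 𝔭)) = maximalIdeal (Localization.AtPrime 𝔭))
    (W : Fin 2 → ℕ) (hW : ∀ i, 0 < W i) :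
    ∃ h ∉ 𝔭,
      (∀ (𝔮 : Ideal A) [𝔮.IsPrime], h ∉ 𝔮 → IsRegularLocalRing (Localization.AtPrime 𝔮)) ∧
      (∀ (𝔮 : Ideal A) [𝔮.IsPrime], h ∉ 𝔮 → x ∈ 𝔮 → g ∈ 𝔮 →
        𝔭 ≤ 𝔮 ∧ IsRegularLocalRing (Localization.AtPrime 𝔮) ∧
        (Ideal.span {x, g}).map (algebraMap A (Localization.AtPrime 𝔮)) = 𝔭.map (algebraMap A (Localization.AtPrime 𝔮)) ∧
        ∃ h𝔮 : ∀ i, algebraMap A (Localization.AtPrime 𝔮) ((![x, g] : Fin 2 → A) i) ∈ maximalIdeal (Localization.AtPrime 𝔮),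
          LinearIndependent (ResidueField (Localization.AtPrime 𝔮)) fun i =>
            (maximalIdeal (Localization.AtPrime 𝔮)).toCotangent ⟨algebraMap A _ ((![x, g] : Fin 2 → A) i), h𝔮 i⟩) ∧
      ∀ h' : A,
        IsRegularRing (Localization.Away (h * h')) ∧
        IsRegularRing (extReesAlgebra (weightedMonomialIdeal
          (fun i => algebraMap A (Localization.Away (h * h')) ((![x, g] : Fin 2 → A) i)) W)) ∧
        (algebraMap (Localization.Away (h * h')) (extReesAlgebra (weightedMonomialIdeal
          (fun i => algebraMap A (Localization.Away (h * h')) ((![x, g] : Fin 2 → A) i)) W))).FinitePresentation ∧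
        (∀ (𝔫 : Ideal (extReesAlgebra (weightedMonomialIdeal
            (fun i => algebraMap A (Localization.Away (h * h')) ((![x, g] : Fin 2 → A) i)) W))),
          extReesAlgebra.tInv _ ∈ 𝔫 →
            Ideal.span (Set.range fun i => algebraMap A (Localization.Away (h * h')) ((![x, g] : Fin 2 → A) i)) ≤
              𝔫.comap (algebraMap _ _)) ∧
        ∀ (t X G : extReesAlgebra (weightedMonomialIdeal
            (fun i => algebraMap A (Localization.Away (h * h')) ((![x, g] : Fin 2 → A) i)) W)) (n : ℕ),
          IsConstructible {𝔫 : PrimeSpectrum (extReesAlgebra (weightedMonomialIdeal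
              (fun i => algebraMap A (Localization.Away (h * h')) ((![x, g] : Fin 2 → A) i)) W)) |
            t ∈ 𝔫.asIdeal ∧ X ∉ 𝔫.asIdeal ∧
              algebraMap _ (Localization.AtPrime 𝔫.asIdeal) G ∈ maximalIdeal (Localization.AtPrime 𝔫.asIdeal) ^ n} := by
  haveI : IsNoetherianRing A := Algebra.FiniteType.isNoetherianRing k A
  obtain ⟨h, hh𝔭, Hreg, Hpair, H⟩ := exists_basicOpen_isRegularRing_globalMove' k A 𝔭 hdim x g hxg W hW
  refine ⟨h, hh𝔭, Hreg, Hpair, fun h' => ?_⟩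
  obtain ⟨hAreg, hFT, hBreg, -⟩ := H h'
  haveI : IsNoetherianRing (Localization.Away (h * h')) :=
    IsLocalization.isNoetherianRing (Submonoid.powers (h * h')) (Localization.Away (h * h')) inferInstance
  haveI := hBreg
  haveI : Algebra.FiniteType k (Localization.Away (h * h')) :=
    Algebra.FiniteType.trans (S := A) inferInstance (IsLocalization.finiteType_of_monoid_fg (Submonoid.powers (h * h')) _)
  haveI := hFT
  haveI : Algebra.FiniteType k (extReesAlgebra (weightedMonomialIdeal
      (fun i => algebraMap A (Localization.Away (h * h')) ((![x, g] : Fin 2 → A) i)) W)) :=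
    Algebra.FiniteType.trans (S := Localization.Away (h * h')) inferInstance inferInstance
  exact ⟨hAreg, hBreg, finitePresentation_algebraMap_extReesAlgebra_weightedMonomialIdeal _ _,
    fun 𝔫 ht => span_range_le_comap_of_tInv_mem _ _ hW 𝔫 ht, fun t X G n => isConstructible_noDropLocus k _ t X G n⟩

end ContactCylinder

end Summit.ResolutionOfSingularities.ResolutionOfSingularities.Theorems

end
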